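import Literature.IUT.HodgeTheaters.PiAvatarKitCore
import Literature.IUT.HodgeTheaters.KitCoreBridge
import HarnessLib

/-!
# [IUTchI] Rmk 6.12.2 (ii) / Def 6.13 (i)(c), (ii)(c) AT THE GENUINE KIT: the gluing of a `Θ^{±ell}`-Hodge theater and a `ΘNF`-Hodge theater
# along their `𝒟`-prime-strips is UNIQUE — FACT-LIST F-2049 `GluingUnique`, F-2682 `GluingUniqueBad` at the NAMED INSTANCE
# `baseKitNFStandIn` of the REAL initial Θ-data, for EVERY ΘNF-side kit over it (proof-only; post-freeze additive D13, not a cone member)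

S. Mochizuki, *Inter-universal Teichmüller theory I*, kurims manuscript (May 2020), Rmk 6.12.2 (ii) p. 174 («by Proposition 4.8, (ii); Corollary 5.6,
(ii), the gluing isomorphism that occurs in such a gluing operation is unique»), Def 6.13 (i)(c) p. 182 («the [necessarily unique!] gluing isomorphism
between `†ℋ𝒯^{Θ±ell}` and `†ℋ𝒯^{ΘNF}`»), (ii)(c) p. 183, Prop 6.7 p. 167 ([IUTchI] Rmk 6.12.2 (ii) p.174) [claim: Mochizuki2012, status: disputed] (D-0012 claim
key, series status DISPUTED — kernel theorems over abc-iut-L5-t2's REAL `InitialThetaData`, abc-iut-L5-t4's NF-widened stand-in kit `baseKitNFStandIn`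
(p450281), abc-iut-L5-t3's genuine §4 datum / `KitCore` `kitCoreStandIn` (p452433) and abc-iut-L5-t5's ΘNF-side kit interface `S5Local`; nothing of the
series is asserted, no side is taken on [IUTchIII] Cor. 3.12).

WHAT (L5-lead RULINGS #77 (1): «F-2049 at the genuine kit = `KitCore.gluingUnique`»; XCITES rows F-2049/F-2682, owner abc-iut-L5-t3).  FACT-LIST F-2049
`S5Local.GluingUnique` and F-2682 `S5Local.GluingUniqueBad` are parametrised statements «AT NAMED INSTANCES ONLY» (universal closure refuted by f-028 /
w4-d068: a kit with a bad place and no §4 datum behind its `φ^Θ`'s need not glue uniquely).  abc-iut-L5-t3's `KitCore.gluingUnique` (KitCoreBridge,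
p416134+; w4-d056's label-rigidity route) proves them for every kit IN `𝒟`-DICTIONARY WITH A §4 DATUM whose Example 4.4 classes AGREE with the kit's
(`ThetaAgrees`).  At the REAL initial Θ-data that dictionary now EXISTS (`kitCoreStandIn`, p452433) and (γ) `ThetaAgrees` is the theorem
`thetaAgrees_standIn` for Example 4.4's classes generated by a multiplicative kit `Mk` (inputs `Z`/`hne`/`hrig`/`hsat` BY NAME).  Hence, for EVERY
`F`-kit `FK` and EVERY ΘNF-side kit `N : S5Local Mk FK` over `baseKitNFStandIn`: **`gluingUnique_standIn`** (F-2049), **`gluingUniqueBad_standIn`** (F-2682),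
**`dGluing_subsingleton_standIn`** (Def 6.13 (ii)(c)), with `Odd l` from Def 3.1 (c) (`odd_l`) and the bad place from Def 3.1 (b) (`indexCopyBad_nonempty`).
BINDERS, exhaustively: {`CG`, `hS`, `M`, `hA`, `hI`} (kit), the Θ-side `Mk` with Example 4.4's `Z`, `hne`, `hrig`, `hsat` (junction J-Θ-1: stand-ins in
the Π-avatar at `v̲ ∈ V̲^bad`), and the universally quantified `FK`, `N`.  Proof-only; no instance, no notation; typed ≠ inhabited ≠ proved; binder ≠ fact.
-/

noncomputable section

namespace Literature.IUT.HodgeTheaters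

open CategoryTheory

universe u v w

section KitCoreGluing

variable {F : Type u} {K : Type v} {Fbar : Type w} [Field F] [NumberField F] [Field K] [NumberField K]
  [Algebra F K] [Field Fbar] [Algebra F Fbar] [Algebra K Fbar]
  {E : WeierstrassCurve F} [E.IsElliptic] {l : ℕ} {Pb : BadPlacePredicates K}
  (D : InitialThetaData F K Fbar E l Pb) (CG : D.geom.pe.CuspGalois) (hS : D.CuspClassesNormaliserStable) [Fact l.Prime]
  (M : D.TorsionMonodromy) (hA : D.geom.pe.ArrowCoveringClaims)
  (hI : ∀ k ∈ D.geom.pe.inertia D.geom.pe.ε1, M.tau (D.geom.embK k) = 0)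

namespace InitialThetaData

omit [Fact l.Prime] in
/-- `l` is odd (Def 3.1 (c): `l ≥ 5` prime). ([IUTchI] Def 3.1 (c) p.61) [claim: Mochizuki2012, status: disputed] -/
theorem odd_l (D : InitialThetaData F K Fbar E l Pb) : Odd l :=
  D.l_prime.odd_of_ne_two (by have := D.five_le_l; omega)

variable (Mk : (D.baseKitNFStandIn CG hS M hA hI).MultKit)
  (Z : ∀ x : D.IndexCopy, x ∈ D.indexCopyBad →
    Set ((D.baseKitNFStandIn CG hS M hA hI).model x ⟶ (D.baseKitNFStandIn CG hS M hA hI).model x))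
  (hne : ∀ x (hx : x ∈ D.indexCopyBad) j, (Mk.polyOfLabel D.five_le_l Z x hx j).Nonempty)
  (hrig : ∀ x (hx : x ∈ D.indexCopyBad) {j j' : FlAbs l}
    {g g' : (D.baseKitNFStandIn CG hS M hA hI).model x ⟶ (D.baseKitNFStandIn CG hS M hA hI).model x}
    (θ β : (D.baseKitNFStandIn CG hS M hA hI).model x ≅ (D.baseKitNFStandIn CG hS M hA hI).model x),
    g ∈ Mk.polyOfLabel D.five_le_l Z x hx j → g' ∈ Mk.polyOfLabel D.five_le_l Z x hx j' → g' = θ.hom ≫ g ≫ β.hom → j = j')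
  (hsat : ∀ x (hx : x ∈ D.indexCopyBad) (j : Fin (lStar l))
    (θ β : (D.baseKitNFStandIn CG hS M hA hI).model x ≅ (D.baseKitNFStandIn CG hS M hA hI).model x)
    {g : (D.baseKitNFStandIn CG hS M hA hI).model x ⟶ (D.baseKitNFStandIn CG hS M hA hI).model x},
    g ∈ Mk.thetaPolyBad j x hx → θ.hom ≫ g ≫ β.hom ∈ Mk.thetaPolyBad j x hx)

include Z hne hrig hsat

/-- **F-2049 `GluingUnique` AT THE GENUINE KIT** ([IUTchI] Rmk 6.12.2 (ii) / Def 6.13 (i)(c): the gluing of `†ℋ𝒯^{Θ±ell}` and `†ℋ𝒯^{ΘNF}` is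
unique): for EVERY `F`-kit `FK` and EVERY ΘNF-side kit `N` over the NF-widened stand-in base kit of the real initial Θ-data, given a multiplicative kit
`Mk` carrying Example 4.4's classes (`Z`, `hne`, `hrig`, `hsat`) — via the genuine `KitCore` and (γ). ([IUTchI] Rmk 6.12.2 (ii) p.174) [claim: Mochizuki2012, status: disputed] -/
theorem gluingUnique_standIn {FK : (D.baseKitNFStandIn CG hS M hA hI).FKit Mk}
    (N : (D.baseKitNFStandIn CG hS M hA hI).S5Local Mk FK) : N.GluingUnique D.odd_l := by
  obtain ⟨x, hx⟩ := D.indexCopyBad_nonempty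
  exact BaseThetaDatum.KitCore.gluingUnique (D.thetaAgrees_standIn CG hS M hA hI Mk Z hne hrig hsat) D.odd_l N hx

/-- **F-2682 `GluingUniqueBad` AT THE GENUINE KIT** (abc-iut-L5-t5's guarded form `𝕍^bad ≠ ∅ → GluingUnique`).
([IUTchI] Rmk 6.12.2 (ii) p.174) [claim: Mochizuki2012, status: disputed] -/
theorem gluingUniqueBad_standIn {FK : (D.baseKitNFStandIn CG hS M hA hI).FKit Mk}
    (N : (D.baseKitNFStandIn CG hS M hA hI).S5Local Mk FK) : N.GluingUniqueBad D.odd_l :=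
  BaseThetaDatum.KitCore.gluingUniqueBad (D.thetaAgrees_standIn CG hS M hA hI Mk Z hne hrig hsat) D.odd_l N

/-- **[IUTchI] Def 6.13 (ii)(c) AT THE GENUINE KIT**: the `𝒟`-level gluing of a `𝒟-ΘNF`-Hodge theater to a `𝒟-Θ^±`-bridge via Proposition 6.7 is
unique. ([IUTchI] Def 6.13 (ii) p.183) [claim: Mochizuki2012, status: disputed] -/
theorem dGluing_subsingleton_standIn {FK : (D.baseKitNFStandIn CG hS M hA hI).FKit Mk}
    (N : (D.baseKitNFStandIn CG hS M hA hI).S5Local Mk FK) (B : (D.baseKitNFStandIn CG hS M hA hI).DThetaPMBridge) (X : N.DNFHT) :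
    Subsingleton (N.DThetaGluing B X D.odd_l) := by
  obtain ⟨x, hx⟩ := D.indexCopyBad_nonempty
  exact BaseThetaDatum.KitCore.dGluing_subsingleton (D.thetaAgrees_standIn CG hS M hA hI Mk Z hne hrig hsat) D.odd_l N hx B X

end InitialThetaData

end KitCoreGluing

end Literature.IUT.HodgeTheaters
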